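import Literature.IUT.HodgeTheaters.PiAvatarLocalAmbientNF
import Literature.IUT.HodgeTheaters.PiAvatarBaseKitStandIn
import HarnessLib

/-!
# J-NF-1: the [IUTchI] §6 base kit RE-TYPED over the NF-widened ambient `AmbNF` (so that Def 4.1 (vi)'s `φ^NF_{•,v̲} : †𝒟_v̲ → †𝒟^⊚`
# is a morphism of the kit's ambient) — `baseKitNFOfData`, `baseKitNF`, `baseKitNFStandIn`, `baseKitNFOfBadPairs`, with (α), (β) and
# the §6 consumers re-derived ([IUTchI] Def 6.1, Def 4.1 (vi); defs + laws — post-freeze additive D13, not a cone member)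

S. Mochizuki, *Inter-universal Teichmüller theory I*, kurims manuscript (May 2020), Def 6.1 (ii)–(vii) pp. 156–159, Def 4.1 (v)(vi) pp. 97–98
(`𝒟^⊚ := ℬ(C̲_K)⁰`; the morphisms `†𝒟_v → †𝒟^⊚`), Ex 6.3 (i)(ii) p. 161, Prop 6.6 (ii)(iii) p. 165, Prop 6.8 (i) p. 167; pages = kurims
preprint render ([IUTchI] Def 6.1 (vii) p.159) [claim: Mochizuki2012, status: disputed] (D-0012 claim key, series status DISPUTED — constructions
over abc-iut-L5-t2's REAL `InitialThetaData`; nothing of the series is asserted, no side is taken on [IUTchIII] Cor. 3.12).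

## Junction note «J-NF-1» (abc-iut-L5-lead RULINGS #67 (3), #70 (7); finding by abc-iut-L5-t3 g6)
«J-NF-1: ambient widened by the `𝒟^⊚`-isomorph disjunct so that Def 4.1 (vi) `φ^NF_{•,v̲}` types; Θ-side kit unchanged.» The accepted
kits `baseKitOfData` (p444202) / `baseKit` (p445979) / `baseKitOfTorsionMonodromy` (p446463) / `baseKitArrowStandIn` (p447892) /
`baseKitStandIn`, `baseKitOfBadPairs` (p448457) have `Amb v := (δ v).InPlay.FullSubcategory`, whose objects are isomorphs of `𝒟_v̲`,
`†𝒟_v̲^±`, `𝒟^{⊚±}` only — no object can carry `†𝒟^⊚`, so `PMBaseKit.NFKit` (which needs `nfAtV : GlobNF ⥤ Amb v`) cannot be assembled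
over them faithfully. This file is ADDITIVE (those files are not edited): the SAME slot values re-typed over abc-iut-L5-t3's
`(δ v).AmbNF := (δ.InPlayNF).FullSubcategory`, `InPlayNF X := InPlay X ∨ IsGlobNFIsomorph X` (PiAvatarLocalAmbientNF, p-file of t3 g6). Every kit law transfers verbatim; the one
extra case (`labOfHom_post` at an isomorph of `𝒟^⊚`) is VACUOUS — `Hom(†𝒟^⊚, †𝒟^{⊚±}) = ∅` by (L1) + `exists_neg` of the local datum
(t3's `LocalDatum.labOfHomAmb_post_of_inPlayNF`); `pmPair`'s junk branch `⟨X, 𝟙⟩` covers the new objects. NEW, for the NF side: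
`nfAtVNF : GlobNF ⥤ AmbNF` (inclusion) and `projAtNF := globCover` seen at `v` (the slots `NFKit.nfAtV` / `NFKit.projAt` will be these).

## What is built
* slots `LocalDatum.modelNF / atVNF / nfAtVNF / phiEllNF / projAtNF / pmPairNF` (+ `rfl` lemmas);
* **`baseKitNFOfData CG hS hsurj bad arc δ : PMBaseKit.{w} l`** (the p444202 record with `Amb v := (δ v).AmbNF`); (α) `phiEllSync_baseKitNFOfData`,
  (β) `negCompatModel_baseKitNFOfData` (the p444756 scripts);
* `baseKitNF B CG hS hsurj hA Λ` (over `V̲`, cf. p445979), **`baseKitNFOfBadPairs CG hS M hA hI B ΛBad`** (genuine shape; binders as in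
  `baseKitOfBadPairs`) and **`baseKitNFStandIn CG hS M hA hI`** («[`X̲→`-profinite stand-in at `v̲ ∈ V̲^bad`]», binders the five standing
  ones), each with (α)(β) and Prop 6.6 (ii)(iii) / 6.8 (i) / Ex 6.3 (ii).
No instance, no notation; typed ≠ inhabited ≠ proved; binders ≠ facts; a stand-in is not the tempered datum of [EtTh].
-/

noncomputable section

namespace Literature.IUT.HodgeTheaters

open CategoryTheory

open scoped Pointwise

universe u v w

section BaseKitNF

variable {F : Type u} {K : Type v} {Fbar : Type w} [Field F] [NumberField F] [Field K] [NumberField K]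
  [Algebra F K] [Field Fbar] [Algebra F Fbar] [Algebra K Fbar]
  {E : WeierstrassCurve F} [E.IsElliptic] {l : ℕ} {Pb : BadPlacePredicates K}
  (D : InitialThetaData F K Fbar E l Pb) (CG : D.geom.pe.CuspGalois) (hS : D.CuspClassesNormaliserStable) [Fact l.Prime]

namespace InitialThetaData

namespace LocalDatum

variable {D CG hS} (δ : D.LocalDatum CG hS)

/-! ### The slot values re-typed over `AmbNF` -/

/-- `𝒟_v̲` as an object of the NF-widened ambient. ([IUTchI] Def 4.1 (i) p.95) [claim: Mochizuki2012, status: disputed] -/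
def modelNF : δ.AmbNF := ⟨δ.locObj, δ.inPlay_le_inPlayNF _ (Or.inl ⟨Iso.refl _⟩)⟩

/-- Its underlying ambient object is `ℬ(Π_v̲)⁰`. ([IUTchI] Def 4.1 (i) p.95) [claim: Mochizuki2012, status: disputed] -/
@[simp] theorem modelNF_obj : δ.modelNF.obj = δ.locObj := rfl

/-- **Slot `atV v : Glob ⥤ AmbNF v`** (inclusion of full subcategories). ([IUTchI] Def 6.1 (vii) p.159) [claim: Mochizuki2012, status: disputed] -/
def atVNF : D.Glob ⥤ δ.AmbNF := ObjectProperty.ιOfLE δ.isGlobIsomorph_le_inPlayNF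

/-- `atVNF` keeps underlying objects. ([IUTchI] Def 6.1 (vii) p.159) [claim: Mochizuki2012, status: disputed] -/
@[simp] theorem atVNF_obj_obj (G : D.Glob) : ((δ.atVNF).obj G).obj = G.obj := rfl

/-- `atVNF` keeps underlying morphisms. ([IUTchI] Def 6.1 (vii) p.159) [claim: Mochizuki2012, status: disputed] -/
@[simp] theorem atVNF_map_hom {G G' : D.Glob} (f : G ⟶ G') : ((δ.atVNF).map f).hom = f.hom := rfl

/-- **Slot `NFKit.nfAtV v : GlobNF ⥤ AmbNF v`** — an isomorph `†𝒟^⊚` SEEN AT `v̲` (Def 4.1 (vi)); the inclusion of full subcategories.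
([IUTchI] Def 4.1 (vi) p.98) [claim: Mochizuki2012, status: disputed] -/
def nfAtVNF : D.GlobNF ⥤ δ.AmbNF := ObjectProperty.ιOfLE δ.isGlobNFIsomorph_le_inPlayNF

/-- `nfAtVNF` keeps underlying objects. ([IUTchI] Def 4.1 (vi) p.98) [claim: Mochizuki2012, status: disputed] -/
@[simp] theorem nfAtVNF_obj_obj (G : D.GlobNF) : ((δ.nfAtVNF).obj G).obj = G.obj := rfl

/-- `nfAtVNF` keeps underlying morphisms. ([IUTchI] Def 4.1 (vi) p.98) [claim: Mochizuki2012, status: disputed] -/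
@[simp] theorem nfAtVNF_map_hom {G G' : D.GlobNF} (f : G ⟶ G') : ((δ.nfAtVNF).map f).hom = f.hom := rfl

/-- **Slot `phiEll v`** re-typed: `φ^{Θell}_{•,v̲} : 𝒟_v̲ → 𝒟^{⊚±}` seen at `v̲`. ([IUTchI] Ex 6.3 (i) p.161) [claim: Mochizuki2012, status: disputed] -/
def phiEllNF : δ.modelNF ⟶ (δ.atVNF).obj D.gModel := ObjectProperty.homMk δ.phiEllAmb

/-- Its underlying morphism is `phiEllAmb`. ([IUTchI] Ex 6.3 (i) p.161) [claim: Mochizuki2012, status: disputed] -/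
theorem phiEllNF_hom : (δ.phiEllNF).hom = δ.phiEllAmb := rfl

/-- **Slot `NFKit.projAt v`**: the double covering `𝒟^{⊚±} → 𝒟^⊚` (`globCover`) seen at `v̲`. ([IUTchI] Def 6.1 (v) p.158) [claim: Mochizuki2012, status: disputed] -/
def projAtNF : (δ.atVNF).obj D.gModel ⟶ (δ.nfAtVNF).obj D.gnfModel := ObjectProperty.homMk D.globCover

/-- Its underlying morphism is `globCover`. ([IUTchI] Def 6.1 (v) p.158) [claim: Mochizuki2012, status: disputed] -/
theorem projAtNF_hom : (δ.projAtNF).hom = D.globCover := rfl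

open Classical in
/-- **Slots `pmObj`/`toPM`** re-typed (p444202's `pmPair`; the junk branch `⟨X, 𝟙⟩` also covers the isomorphs of `𝒟^⊚`).
([IUTchI] Def 6.1 (ii) p.156) [claim: Mochizuki2012, status: disputed] -/
def pmPairNF (X : δ.AmbNF) : Σ Y : δ.AmbNF, (X ⟶ Y) :=
  if hX : Nonempty (X.obj ≅ δ.locObj) then
    ⟨⟨OrbitCat.of (MulAut.conj (δ.conjugator hX) • δ.Hund), δ.inPlay_le_inPlayNF _
        (Or.inr (Or.inl ⟨OrbitCat.isoOfConj (δ.conjugator hX) (δ.conj_und_mem (δ.conjugator hX))⟩))⟩,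
      ObjectProperty.homMk (OrbitCat.homOfElem 1 (δ.sub_le_conj_und hX))⟩
  else ⟨X, 𝟙 X⟩

end LocalDatum

/-! ### The kit over `AmbNF` -/

variable [(D.PiXund.subgroupOf D.PiXK).Normal] (hsurj : Function.Surjective D.toFlStarGlobal)
  {V : Type} [DecidableEq V] (bad arc : Finset V) (δ : V → D.LocalDatum CG hS)

/-- **THE BASE KIT OVER THE NF-WIDENED AMBIENT** — p444202's record with `Amb v := (δ v).AmbNF` (J-NF-1); all other slot VALUES unchanged.
([IUTchI] Def 6.1 (ii)-(vii) pp.156-159) [claim: Mochizuki2012, status: disputed] -/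
def baseKitNFOfData : PMBaseKit.{w} l where
  V := V
  bad := bad
  arc := arc
  Amb v := (δ v).AmbNF
  model v := (δ v).modelNF
  pmObj v X := ((δ v).pmPairNF X).1
  toPM v X := ((δ v).pmPairNF X).2
  LabCuspPM _ _ := D.geom.pe.Cusp
  labPM _ _ _ := D.gLabPMModel CG
  labMap := fun v {X} {Y} φ => (δ v).labMapAmb (((δ v).InPlayNF).ι.mapIso φ)
  labMap_refl v X := by
    rw [Functor.mapIso_refl]
    exact (δ v).labMapAmb_refl _
  labMap_trans := fun v {X} {Y} {Z} φ ψ => by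
    change (δ v).labMapAmb (((δ v).InPlayNF).ι.mapIso (φ ≪≫ ψ)) = _
    rw [Functor.mapIso_trans]
    exact (δ v).labMapAmb_trans _ _
  labMap_charts := fun v {X} {Y} hX _ φ e he =>
    (δ v).labMapAmb_trans_mem_charts ⟨((δ v).InPlayNF).ι.mapIso hX.some⟩ _ he
  exists_negative v X hX := by
    obtain ⟨α₀, hα₀⟩ := (δ v).exists_labMapAmb_ne_refl (X := X.obj) ⟨((δ v).InPlayNF).ι.mapIso hX.some⟩
    refine ⟨((δ v).InPlayNF).isoMk α₀, ?_⟩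
    have h : ((δ v).InPlayNF).ι.mapIso (((δ v).InPlayNF).isoMk α₀ : X ≅ X) = α₀ := Iso.ext rfl
    change (δ v).labMapAmb (((δ v).InPlayNF).ι.mapIso (((δ v).InPlayNF).isoMk α₀ : X ≅ X)) ≠ _
    rw [h]
    exact hα₀
  Glob := D.Glob
  gModel := D.gModel
  gIso := D.gIso
  GLab := D.GLabOf
  gLabMap := fun {G} {H} φ => D.gLabIso CG hS φ
  gLabMap_refl := D.gLabIso_refl CG hS
  gLabMap_trans := fun {G} {H} {J} φ ψ => D.gLabIso_trans CG hS φ ψ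
  toFlStar := D.toFlStarOf
  toFlStar_surjective := D.toFlStarOf_surjective_of hsurj
  gLabT := D.gLabTModel CG
  gChart₀ := D.gChart₀Model CG
  gChart₀_mem := D.gChart₀Model_mem_charts CG
  autCsp_le := D.autCsp_le_of CG hS
  gLab_range := D.gLab_range_of CG hS
  atV v := (δ v).atVNF
  phiEll v := (δ v).phiEllNF
  labOfHom := fun v {X} {G} f => (δ v).labOfHomAmb (G := G) f.hom
  labOfHom_pre := fun v {X} {Y} {G} φ f => (δ v).labOfHomAmb_pre (((δ v).InPlayNF).ι.mapIso φ) f.hom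
  labOfHom_post := fun v {X} {G} {H} f ψ => (δ v).labOfHomAmb_post_of_inPlayNF X.property f.hom ψ
  labOfHom_phiEll_bijective v := by
    change Function.Bijective ((δ v).labOfHomAmb (G := D.gModel) (δ v).phiEllAmb)
    rw [(δ v).labOfHomAmb_phiEllAmb]
    exact Function.bijective_id
  labOfHom_phiEll_charts v e he := by
    have key : ∀ (g : D.geom.pe.Cusp → D.geom.pe.Cusp) (hb : Function.Bijective g), g = id →
        (Equiv.ofBijective g hb).symm.trans e = e := by
      rintro g hb rfl
      ext x
      change e ((Equiv.ofBijective id hb).symm x) = e x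
      congr 1
      exact Equiv.ofBijective_apply_symm_apply id hb x
    have hid : (δ v).labOfHomAmb (G := D.gModel) (δ v).phiEllNF.hom = id := (δ v).labOfHomAmb_phiEllAmb
    rw [key _ _ hid]
    exact (D.gLabPMModel CG).mem_toTorsor_charts he

/-- The ambient of the NF kit at an index is `AmbNF`. ([IUTchI] Def 6.1 (vii) p.159) [claim: Mochizuki2012, status: disputed] -/
theorem baseKitNFOfData_Amb (v : V) : (D.baseKitNFOfData CG hS hsurj bad arc δ).Amb v = (δ v).AmbNF := rfl

/-- The model object of the NF kit at an index is `ℬ(Π_v̲)⁰`. ([IUTchI] Def 4.1 (i) p.95) [claim: Mochizuki2012, status: disputed] -/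
theorem baseKitNFOfData_model_obj (v : V) : ((D.baseKitNFOfData CG hS hsurj bad arc δ).model v).obj = (δ v).locObj := rfl

/-! ### (α) and (β) at the NF kit (the p444756 scripts) -/

/-- **(α) `PhiEllSync`** at the NF kit. ([IUTchI] Ex 6.3 (i) p.161) [claim: Mochizuki2012, status: disputed] -/
theorem phiEllSync_baseKitNFOfData : PMBaseKit.Ex63.PhiEllSync (D.baseKitNFOfData CG hS hsurj bad arc δ) := by
  intro v e he
  obtain ⟨ε, hε⟩ := (CG.mem_labPM_charts_iff D.geom.PiXbar_relIndex e).mp he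
  have key : ∀ (g : D.geom.pe.Cusp → D.geom.pe.Cusp) (hb : Function.Bijective g), g = id →
      (Equiv.ofBijective g hb).symm.trans e = e := by
    rintro g hb rfl
    ext x
    change e ((Equiv.ofBijective id hb).symm x) = e x
    congr 1
    exact Equiv.ofBijective_apply_symm_apply id hb x
  have h1 : (Equiv.ofBijective _ ((D.baseKitNFOfData CG hS hsurj bad arc δ).labOfHom_phiEll_bijective v)).symm.trans e = e :=
    key _ _ ((δ v).labOfHomAmb_phiEllAmb)
  exact ⟨ε, by rw [h1, hε]; rfl⟩

/-- The automorphism `xΠ ↦ xcΠ` of `𝒟^{⊚±}` for `c ∈ Π_{C̲_K} ∖ Π_{X̲_K}` is a lift of `(0,−1)` in the NF kit. ([IUTchI] Ex 6.3 (ii) p.161) [claim: Mochizuki2012, status: disputed] -/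
theorem isoMk_autOfNormalizer_mem_lifts_NF {c : D.PiC} (hc : c ∈ D.PiCund) (hcX : c ∉ D.PiXund)
    (hcn : c ∈ Subgroup.normalizer ((D.PiXund : Subgroup D.PiC) : Set D.PiC)) :
    (D.IsGlobIsomorph).isoMk (X := D.gModel) (Y := D.gModel) (OrbitCat.autOfNormalizer (H := D.PiXund) c hcn) ∈
      PMBaseKit.Ex63.lifts (D.baseKitNFOfData CG hS hsurj bad arc δ) (FlPM.mk 0 (-1)) := by
  refine ⟨?_, ?_⟩
  · rw [PMBaseKit.mem_autPMg_iff]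
    change D.toFlStarOf D.gModel ((D.IsGlobIsomorph).isoMk (X := D.gModel) (Y := D.gModel)
      (OrbitCat.autOfNormalizer (H := D.PiXund) c hcn)) = 1
    rw [D.toFlStarOf_gModel_isoMk]
    exact D.toFlStarGlobal_autOfNormalizer_eq_one_of_mem_PiCund hc hcn
  · have key : D.gLabIso CG hS ((D.IsGlobIsomorph).isoMk (X := D.gModel) (Y := D.gModel)
        (OrbitCat.autOfNormalizer (H := D.PiXund) c hcn)) =
        (D.gChart₀Model CG).trans ((FlPM.toPerm l (FlPM.mk 0 (-1))).trans (D.gChart₀Model CG).symm) := by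
      rw [D.gLabIso_isoMk CG hS]
      refine Equiv.ext fun x => (D.gChart₀Model CG).injective ?_
      rw [D.gChart₀Model_gLabAutModel_of_not_mem_PiXund CG hS c hc hcX hcn x]
      simp
    exact key

/-- **(β) `NegCompatModel`** at the NF kit. ([IUTchI] Ex 6.3 (ii) p.161) [claim: Mochizuki2012, status: disputed] -/
theorem negCompatModel_baseKitNFOfData : PMBaseKit.Ex63.NegCompatModel (D.baseKitNFOfData CG hS hsurj bad arc δ) := by
  refine fun (v : V) => ?_
  obtain ⟨c, hcH, hc, hcX⟩ := (δ v).exists_neg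
  have hcn : c ∈ Subgroup.normalizer ((D.PiXund : Subgroup D.PiC) : Set D.PiC) := (δ v).law.normalizer_le hcH
  let a₀ : (δ v).locObj ≅ (δ v).locObj := OrbitCat.autOfNormalizer (H := (δ v).H) c hcH
  refine ⟨((δ v).InPlayNF).isoMk (X := (δ v).modelNF) (Y := (δ v).modelNF) a₀, ?_,
    (D.IsGlobIsomorph).isoMk (X := D.gModel) (Y := D.gModel) (OrbitCat.autOfNormalizer (H := D.PiXund) c hcn),
    D.isoMk_autOfNormalizer_mem_lifts_NF CG hS hsurj bad arc δ hc hcX hcn, ?_⟩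
  · rcases PMBaseKit.labMap_eq_refl_or_labNeg ((D.baseKitNFOfData CG hS hsurj bad arc δ).isLocal_model v)
      (((δ v).InPlayNF).isoMk (X := (δ v).modelNF) (Y := (δ v).modelNF) a₀) with h | h
    · exfalso
      apply (δ v).law.locLabAut_ne_one_of_not_mem hcH hc hcX
      have h' : (δ v).labMapAmb a₀ = Equiv.refl _ := h
      rw [(δ v).labMapAmb_locObj] at h'
      exact h'
    · exact h
  · apply (δ v).InPlayNF.hom_ext
    exact OrbitCat.autOfNormalizer_comp_incl ((δ v).le_und.trans (δ v).und_le) hcH hcn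

end InitialThetaData

end BaseKitNF

end Literature.IUT.HodgeTheaters
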